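import Literature.AlgebraicTopology.Homotopy.SequenceTelescopeCW
import Literature.AlgebraicTopology.Homotopy.ManifoldCWType
import HarnessLib

/-!
# Milnor's Theorem 1 (b) ⇒ (a) from the cellular approximation theorem, by mapping telescopes

Topic `Literature/AlgebraicTopology/Homotopy`. The named fact
`Literature.AlgebraicTopology.Homotopy.exists_countable_cwComplex_homotopyEquiv_of_countable_cwDominated`
(`ManifoldCWType.lean`; Milnor, *On spaces having the homotopy type of a CW-complex* (1959),
Thm. 1, (b) ⇒ (a): a space dominated by a countable CW complex has the homotopy type of a
countable CW complex) is PROVED here GIVEN Hatcher's cellular approximation theorem (named fact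
`cellularApproximation`, `CellularApproximation.lean`, Hatcher Thm. 4.8), by the argument printed
in Hatcher, *Algebraic Topology* (2002), proof of Prop. A.11 (p. 528): for a domination
`X →ⁱ C →ᵈ X`, `d ∘ i ≃ 𝟙`,

  `X ≃ T(𝟙, 𝟙, …) ≃ T(di, di, …) ≃ T(id, id, …) ≃ T(g, g, …)`,

`g ≃ i ∘ d` cellular, and the last telescope is a CW complex with countably many cells — using
the tree's abstract telescope (`SequenceTelescope.lean`: `homotopyEquivOfId`,
`homotopyEquivOfHomotopy` = fact (1), `homotopyEquivOfFactorization` = the domination swap) and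
its CW structure (`SequenceTelescopeCW.lean`: `SeqTelescope.cwComplex`, `countable_tcell`).
Consequently Milnor's Corollary 1 (`Manifold.exists_cwComplex_homotopyEquiv`,
`WhiteheadContractibleLeaves.lean`) is reduced to the domination fact
`Manifold.countable_cwDominated` and `cellularApproximation`. No `sorry`.

## References

* J. Milnor, *On spaces having the homotopy type of a CW-complex*, Trans. AMS 90 (1959),
  Thm. 1 (p. 272), Cor. 1. [Milnor1959]
* A. Hatcher, *Algebraic Topology*, CUP (2002), Appendix, proof of Prop. A.11 (p. 528); §4.1
  Thm. 4.8. [HatcherAT2002]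
-/

noncomputable section

open Set Topology unitInterval Function
open scoped ContinuousMap

universe u

namespace Literature.AlgebraicTopology.Homotopy

/-- **Milnor's Theorem 1, (b) ⇒ (a), GIVEN the cellular approximation theorem**: a space `X`
dominated by a countable Hausdorff CW complex `C` (`i : X → C`, `d : C → X`, `d ∘ i ≃ 𝟙`) has
the homotopy type of a countable Hausdorff CW complex — namely the mapping telescope of a
cellular approximation `g ≃ i ∘ d` (Hatcher 2002, proof of Prop. A.11, p. 528:
`X ≃ T(𝟙, 𝟙, …) ≃ T(di, di, …) ≃ T(id, id, …) ≃ T(g, g, …)`, the last a CW complex with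
countably many cells). PROVED from `SeqTelescope.homotopyEquivOfId`,
`SeqTelescope.homotopyEquivOfHomotopy` (fact (1)), `SeqTelescope.homotopyEquivOfFactorization`
(domination swap), `SeqTelescope.cwComplex` and `SeqTelescope.countable_tcell`; the only
remaining hypothesis is Hatcher's Thm. 4.8 (`cellularApproximation`).
[cite: Milnor1959, Thm. 1 (b)⇒(a) (p. 272)] [cite: HatcherAT2002, Prop. A.11 (proof, p. 528)] -/
theorem exists_countable_cwComplex_homotopyEquiv_of_countable_cwDominated_of_cellularApproximation
    (hCA : cellularApproximation.{u, u}) :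
    exists_countable_cwComplex_homotopyEquiv_of_countable_cwDominated.{u} := by
  intro X _ C _ _ _ hC i d hdi
  obtain ⟨g, hg, hgg⟩ := hCA C C (i.comp d)
  letI inst : CWComplex (univ : Set (SeqTelescope (X := fun _ => C) fun _ => g)) :=
    SeqTelescope.cwComplex (X := fun _ => C) (fun _ => g) fun _ => hg
  refine ⟨SeqTelescope (X := fun _ => C) fun _ => g, inferInstance, inferInstance, inst, ?_, ⟨?_⟩⟩
  · exact SeqTelescope.countable_tcell (X := fun _ => C) fun _ => hC
  · have e1 : X ≃ₕ SeqTelescope (X := fun _ => X) (fun _ => ContinuousMap.id X) :=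
      (SeqTelescope.homotopyEquivOfId X).symm
    have e2 : SeqTelescope (X := fun _ => X) (fun _ => ContinuousMap.id X) ≃ₕ
        SeqTelescope (X := fun _ => X) (fun _ => d.comp i) :=
      SeqTelescope.homotopyEquivOfHomotopy (f := fun _ => ContinuousMap.id X)
        (f' := fun _ => d.comp i) fun _ => hdi.symm.some
    have e3 : SeqTelescope (X := fun _ => X) (fun _ => d.comp i) ≃ₕ
        SeqTelescope (X := fun _ => C) (fun _ => i.comp d) :=
      SeqTelescope.homotopyEquivOfFactorization (X := fun _ => X) (Y := fun _ => C)
        (fun _ => d.comp i) (fun _ => i.comp d) (fun _ => i) (fun _ => d) (fun _ _ => rfl) (fun _ _ => rfl)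
    have e4 : SeqTelescope (X := fun _ => C) (fun _ => i.comp d) ≃ₕ
        SeqTelescope (X := fun _ => C) (fun _ => g) :=
      SeqTelescope.homotopyEquivOfHomotopy (f := fun _ => i.comp d) (f' := fun _ => g) fun _ => hgg.some
    exact ((e1.trans e2).trans e3).trans e4

/-- **Milnor 1959, Corollary 1, reduced to the domination of manifolds by countable CW
complexes and to cellular approximation**: the target fact
`Manifold.exists_cwComplex_homotopyEquiv` (every Hausdorff second countable topological
`n`-manifold has the homotopy type of a countable CW complex) follows from
`Manifold.countable_cwDominated` (Milnor Thm. 1 (d)⇒(b) for manifolds) and Hatcher's Thm. 4.8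
(`cellularApproximation`). PROVED. [cite: Milnor1959, Cor. 1 (p. 272)] -/
theorem Manifold.exists_cwComplex_homotopyEquiv_of_countable_cwDominated_of_cellularApproximation
    (hD : Manifold.countable_cwDominated.{u}) (hCA : cellularApproximation.{u, u}) :
    Manifold.exists_cwComplex_homotopyEquiv.{u} :=
  Manifold.exists_cwComplex_homotopyEquiv_of_dominated_facts hD
    (exists_countable_cwComplex_homotopyEquiv_of_countable_cwDominated_of_cellularApproximation hCA)

end Literature.AlgebraicTopology.Homotopy

end
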